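import Literature.NumberTheory.EllipticCurves.GaloisStableDivisibleSubgroupProofs
import Literature.NumberTheory.EllipticCurves.WeilPairingProofs
import Literature.NumberTheory.GaloisRepresentations.AbsGaloisGroup
import HarnessLib

/-!
# `Γ_ℚ` never acts through an abelian quotient on a non-zero divisible subgroup of `E[p^∞]`
# (`p` odd) — Kato's "not abelian" input of Thm. 12.4 (2) for EVERY elliptic curve over `ℚ`

`Proofs` file (theorems only; no definition, no named fact) in topic `NumberTheory/EllipticCurves`,
sequel of `GaloisStableDivisibleSubgroupProofs` (a non-zero `Γ_ℚ`-stable `p`-divisible `p`-primary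
subgroup `D ≤ E(ℚ̄)` contains `E[p]`, hence `E[p^∞]`). Here we add: for `p` odd, **`Γ_ℚ` does not
act on such a `D` through an abelian quotient** (`WeierstrassCurve.not_forall_smul_comm_of_stable_divisible`);
in particular two elements of `Γ_ℚ` fail to commute on `D` — the image of `Γ_ℚ → Aut E[p^∞] ≅
GL₂(ℤ_p)` is non-abelian — for every elliptic curve over `ℚ` and every odd prime `p`
(`WeierstrassCurve.exists_smul_smul_ne_of_stable_divisible`).

This is the Galois-theoretic input of Kato's proof of Thm. 12.4 (2) (Astérisque 295, §13.8,
p. 228: "`H⁰(ℚ, T ⊗ Λ/xΛ) = 0` … Since the action of `Gal(ℚ̄/ℚ)` on `Hom(Λ/xΛ, O_λ)` is abelian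
and the representation of `Gal(ℚ̄/ℚ)` on `V(f)` is irreducible and is not abelian, there is no such
non-trivial homomorphism"), in a form that needs NO irreducibility of `E[p]` (Kato's standing
non-CM / big-image setting of §13): a non-trivial `Γ_ℚ`-homomorphism from a module with abelian
action to `T_pE` would produce exactly a non-zero `Γ_ℚ`-stable divisible subgroup of `E[p^∞]` with
abelian action. Relevant to the REDUCIBLE rows of the cell's crux (rational `p`-isogeny), where
(12.5.2) fails.

## The proof

Suppose `Γ_ℚ` acts on `D` with `σ τ P = τ σ P`. By the sibling, `E[p^k] ≤ D` for all `k`. Let `c`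
be a complex conjugation. The `c`-fixed part `D₊ = {P ∈ E[p^∞] | c P = P}` is `p`-primary,
`Γ_ℚ`-stable (`Γ_ℚ` commutes with `c` on `E[p^∞] ≤ D`) and `p`-divisible (`p` odd: from `p Q = P`
pass to `u (Q + cQ)` with `2u ≡ 1`). By the Weil pairing `e_p` (Silverman, *AEC*, Prop. III.8.1, the
tree's `exists_weilPairing_holds`), on which `c` acts by inversion of the values, `c` is neither
`id` nor `−id` on `E[p]` (either would force `e_p(S, T)² = 1`, i.e. `e_p ≡ 1` for `p` odd, against
non-degeneracy); hence `D₊ ∩ E[p]` is neither `0` (take `Q + cQ ≠ 0`) nor `E[p]`. But the sibling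
applied to `D₊` gives `E[p] ≤ D₊` — a contradiction. NEW FORMAL PROOF.

## References

* [Kato2004Asterisque] K. Kato, Astérisque 295 (2004), §13.8 (p. 228), proof of Thm. 12.4 (2).
* [SilvermanAEC2009] J. H. Silverman, *The Arithmetic of Elliptic Curves*, 2nd ed., Prop. III.8.1.
-/

noncomputable section

open scoped Classical AddSubgroup

universe u

namespace WeierstrassCurve

open Literature.NumberTheory.EllipticCurves Literature.NumberTheory.GaloisRepresentations

variable (W : WeierstrassCurve ℚ) [W.IsElliptic] {p : ℕ} [Fact p.Prime]

/-- **A complex conjugation is neither `id` nor `−id` on `E[p]` (`p` odd).** For an elliptic curve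
`E/ℚ`, an odd prime `p` and a complex conjugation `c ∈ Γ_ℚ`: there are `P, Q ∈ E[p]` with `c P ≠ P`
and `c Q ≠ −Q`. By the Weil pairing `e_p` (Silverman, *AEC*, Prop. III.8.1: bilinear, alternating,
non-degenerate, `Γ_ℚ`-equivariant; the tree's `exists_weilPairing_holds`) and `c ζ = ζ⁻¹` on roots of
unity: `c = ± id` on `E[p]` would give `e_p(S, T) = e_p(cS, cT) = c e_p(S,T) = e_p(S, T)⁻¹`, so
`e_p(S,T)² = 1 = e_p(S,T)^p`, `e_p ≡ 1`, contradicting non-degeneracy (`#E[p] = p² > 1`).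
[cite: SilvermanAEC2009, Prop. III.8.1] -/
theorem exists_smul_ne_and_smul_ne_neg_of_isComplexConjugation (hp2 : p ≠ 2)
    {c : Field.absoluteGaloisGroup ℚ} (hc : IsComplexConjugation (Rat.castHom ℝ) c) :
    (∃ P : geomTorsion W (p : ℤ), c • P ≠ P) ∧ ∃ Q : geomTorsion W (p : ℤ), c • Q ≠ -Q := by
  have hp : p.Prime := Fact.out
  have hpodd : Odd p := hp.eq_two_or_odd'.resolve_left hp2
  have hpQ : ((p : ℕ) : ℚ) ≠ 0 := by exact_mod_cast hp.ne_zero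
  obtain ⟨w, hpow, haddl, haddr, halt, hnd, hgal⟩ := exists_weilPairing_holds W p hp.two_le hpQ
  have hne : ∀ S T, w S T ≠ 0 := fun S T h0 ↦ by
    have := hpow S T
    rw [h0, zero_pow hp.ne_zero] at this
    exact zero_ne_one this
  have hzero_left : ∀ T, w 0 T = 1 := fun T ↦ by
    have h := haddl 0 0 T
    rw [add_zero] at h
    exact (mul_eq_left₀ (hne 0 T)).mp h.symm
  have hzero_right : ∀ S, w S 0 = 1 := fun S ↦ by
    have h := haddr S 0 0
    rw [add_zero] at h
    exact (mul_eq_left₀ (hne S 0)).mp h.symm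
  have hneg : ∀ S T, w (-S) (-T) = w S T := fun S T ↦ by
    have h1 : w (-S) (-T) * w S (-T) = 1 := by rw [← haddl, neg_add_cancel, hzero_left]
    have h2 : w S (-T) * w S T = 1 := by rw [← haddr, neg_add_cancel, hzero_right]
    have h3 : w S (-T) = (w S T)⁻¹ := eq_inv_of_mul_eq_one_left h2
    rw [h3] at h1
    exact (mul_inv_eq_one₀ (hne S T)).mp h1
  -- `c` inverts the values of `w` (roots of unity)
  obtain ⟨ι, -, hι⟩ := isComplexConjugation_iff.mp hc
  have hinv : ∀ S T, c • w S T = (w S T)⁻¹ := fun S T ↦ by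
    have hnorm : ‖ι (w S T)‖ = 1 :=
      Complex.norm_eq_one_of_pow_eq_one (by rw [← map_pow, hpow, map_one]) hp.ne_zero
    apply ι.injective
    rw [hι, ← Complex.inv_eq_conj hnorm, map_inv₀]
  -- a pair with `w S T ≠ 1`, i.e. `w S T ^ 2 ≠ 1`
  obtain ⟨S₀, T₀, hST⟩ : ∃ S T, w S T ≠ 1 := by
    by_contra h
    push Not at h
    haveI : Finite (geomTorsion W (p : ℤ)) := finite_geomTorsion_natCast W hp.ne_zero
    have hall : ∀ T : geomTorsion W (p : ℤ), T = 0 := fun T ↦ hnd T fun S ↦ h S T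
    haveI : Subsingleton (geomTorsion W (p : ℤ)) := ⟨fun a b ↦ by rw [hall a, hall b]⟩
    have hcard := natCard_geomTorsion_eq_sq W hpQ
    rw [Nat.card_of_subsingleton (0 : geomTorsion W (p : ℤ))] at hcard
    have : 1 < p ^ 2 := Nat.one_lt_pow two_ne_zero hp.one_lt
    omega
  have hsq : w S₀ T₀ ^ 2 ≠ 1 := fun h2 ↦ by
    obtain ⟨m, hm⟩ := hpodd
    apply hST
    have := hpow S₀ T₀
    rw [hm, pow_succ, pow_mul, h2, one_pow, one_mul] at this
    exact this
  -- if `c` fixes `S₀, T₀` up to a common sign, `w S₀ T₀` is fixed and inverted by `c`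
  have key : ∀ ε : ℤ, ε = 1 ∨ ε = -1 → c • S₀ = ε • S₀ → c • T₀ = ε • T₀ → False := by
    rintro ε hε hS hT
    have hfix : c • w S₀ T₀ = w S₀ T₀ := by
      rw [hgal, hS, hT]
      rcases hε with rfl | rfl
      · rw [one_smul, one_smul]
      · rw [neg_one_zsmul, neg_one_zsmul, hneg]
    rw [hinv] at hfix
    apply hsq
    rw [pow_two]
    nth_rw 1 [← hfix]
    rw [inv_mul_cancel₀ (hne S₀ T₀)]
  constructor
  · by_contra h
    push Not at h
    exact key 1 (Or.inl rfl) (by rw [h, one_smul]) (by rw [h, one_smul])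
  · by_contra h
    push Not at h
    exact key (-1) (Or.inr rfl) (by rw [h, neg_one_zsmul]) (by rw [h, neg_one_zsmul])

/-- **`Γ_ℚ` does not act through an abelian quotient on a non-zero `Γ_ℚ`-stable `p`-divisible
subgroup of `E[p^∞]` (`p` odd).** For an elliptic curve `E/ℚ`, an odd prime `p` and
`D ≤ E(ℚ̄)` `p`-primary, `p`-divisible, `Γ_ℚ`-stable and non-zero, the elements of `Γ_ℚ` do not
all commute on `D`. Otherwise `E[p^k] ≤ D` (sibling `geomTorsion_pow_le_of_stable_divisible`), the
`c`-fixed part `D₊` of `E[p^∞]` for a complex conjugation `c` is again `p`-primary, `Γ_ℚ`-stable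
(commutativity), `p`-divisible (`p` odd) and non-zero, so `E[p] ≤ D₊` by the sibling — but `c ≠ id`
on `E[p]` (`exists_smul_ne_and_smul_ne_neg_of_isComplexConjugation`). This is Kato's input "the
representation on `V(f)` … is not abelian" for `H⁰(ℚ, T ⊗ Λ/xΛ) = 0` (Astérisque 295, §13.8,
p. 228), here for every `E/ℚ` without any irreducibility hypothesis. NEW FORMAL PROOF.
[cite: Kato2004Asterisque, §13.8 (p. 228)] [cite: SilvermanAEC2009, Prop. III.8.1] -/
theorem not_forall_smul_comm_of_stable_divisible (hp2 : p ≠ 2) {D : AddSubgroup W.geomPoints}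
    (hprim : ∀ P ∈ D, ∃ k : ℕ, p ^ k • P = 0)
    (hdiv : ∀ P ∈ D, ∃ Q ∈ D, p • Q = P)
    (hstab : ∀ (σ : Field.absoluteGaloisGroup ℚ) (P : W.geomPoints), P ∈ D → σ • P ∈ D)
    (hne : D ≠ ⊥) :
    ¬ ∀ (σ τ : Field.absoluteGaloisGroup ℚ) (P : W.geomPoints), P ∈ D → σ • τ • P = τ • σ • P := by
  intro hab
  have hp : p.Prime := Fact.out
  have hpodd : Odd p := hp.eq_two_or_odd'.resolve_left hp2
  have hEk : ∀ k, geomTorsion W ((p ^ k : ℕ) : ℤ) ≤ D :=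
    W.geomTorsion_pow_le_of_stable_divisible hprim hdiv hstab hne
  -- every `p`-primary point lies in `D`
  have hmemD : ∀ P : W.geomPoints, (∃ k : ℕ, p ^ k • P = 0) → P ∈ D := fun P ⟨k, hk⟩ ↦
    hEk k (AddSubgroup.torsionBy.nsmul_iff.mpr hk)
  obtain ⟨c, hc⟩ := exists_isComplexConjugation (Rat.castHom ℝ)
  have hc2 : ∀ P : W.geomPoints, c • c • P = P := fun P ↦ by
    rw [smul_smul, ← pow_two, hc.sq_eq_one, one_smul]
  -- the `c`-fixed part of `E[p^∞]`
  let Dp : AddSubgroup W.geomPoints :=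
    { carrier := {P | (∃ k : ℕ, p ^ k • P = 0) ∧ c • P = P}
      zero_mem' := ⟨⟨0, by rw [pow_zero, one_smul]⟩, smul_zero c⟩
      add_mem' := by
        rintro P Q ⟨⟨k, hk⟩, hP⟩ ⟨⟨l, hl⟩, hQ⟩
        refine ⟨⟨k + l, ?_⟩, by rw [smul_add, hP, hQ]⟩
        rw [smul_add, pow_add, mul_comm, mul_smul, hk, smul_zero, zero_add, mul_comm, mul_smul, hl,
          smul_zero]
      neg_mem' := by
        rintro P ⟨⟨k, hk⟩, hP⟩
        exact ⟨⟨k, by rw [smul_neg, hk, neg_zero]⟩, by rw [smul_neg, hP]⟩ }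
  have hmemDp : ∀ {P : W.geomPoints}, P ∈ Dp ↔ (∃ k : ℕ, p ^ k • P = 0) ∧ c • P = P :=
    fun {P} ↦ Iff.rfl
  have hprim' : ∀ P ∈ Dp, ∃ k : ℕ, p ^ k • P = 0 := fun P hP ↦ (hmemDp.mp hP).1
  have hstab' : ∀ (σ : Field.absoluteGaloisGroup ℚ) (P : W.geomPoints), P ∈ Dp → σ • P ∈ Dp := by
    rintro σ P ⟨⟨k, hk⟩, hP⟩
    refine ⟨⟨k, by rw [smul_comm, hk, smul_zero]⟩, ?_⟩
    rw [hab c σ P (hmemD P ⟨k, hk⟩), hP]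
  have hdiv' : ∀ P ∈ Dp, ∃ Q ∈ Dp, p • Q = P := by
    rintro P ⟨⟨k, hk⟩, hP⟩
    obtain ⟨Q, hQD, hQ⟩ := hdiv P (hmemD P ⟨k, hk⟩)
    obtain ⟨l, hl⟩ := hprim Q hQD
    -- `p^(k+1)` is odd: `2 u = p^(k+1) + 1` with `u = (p^(k+1) + 1)/2`
    obtain ⟨m, hm⟩ : Odd (p ^ (k + 1)) := hpodd.pow
    refine ⟨(m + 1) • (Q + c • Q), ⟨⟨l, ?_⟩, ?_⟩, ?_⟩
    · rw [smul_comm, smul_add, ← smul_comm c, hl, smul_zero, add_zero, smul_zero]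
    · rw [smul_comm, smul_add, hc2, add_comm (c • Q) Q]
    · -- `p • (m+1) • (Q + cQ) = (m+1) • (P + P) = (2m+2) • P = p^(k+1) • P + P = P`
      have hPP : p • (Q + c • Q) = P + P := by rw [smul_add, smul_comm, hQ, hP]
      have hPk1 : p ^ (k + 1) • P = 0 := by rw [pow_succ', mul_smul, hk, smul_zero]
      rw [smul_comm, hPP, ← two_nsmul, smul_smul,
        show (m + 1) * 2 = p ^ (k + 1) + 1 by omega, add_smul, one_smul, hPk1, zero_add]
  -- `Dp` is non-zero and does not contain `E[p]`: `c ≠ -id` and `c ≠ id` on `E[p]`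
  obtain ⟨⟨P₁, hP₁⟩, Q₁, hQ₁⟩ := W.exists_smul_ne_and_smul_ne_neg_of_isComplexConjugation hp2 hc
  have hne' : Dp ≠ ⊥ := by
    intro hbot
    apply hQ₁
    have hmem : (Q₁ : W.geomPoints) + c • (Q₁ : W.geomPoints) ∈ Dp := by
      refine ⟨⟨1, ?_⟩, by rw [smul_add, hc2, add_comm]⟩
      have hQp : p • (Q₁ : W.geomPoints) = 0 := AddSubgroup.torsionBy.nsmul_iff.mp Q₁.2
      rw [pow_one, smul_add, smul_comm, hQp, smul_zero, add_zero]
    rw [hbot, AddSubgroup.mem_bot] at hmem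
    have h' : c • (Q₁ : W.geomPoints) = -(Q₁ : W.geomPoints) := eq_neg_of_add_eq_zero_right hmem
    exact Subtype.ext (by rw [AddSubgroup.torsionBy.coe_smul, NegMemClass.coe_neg]; exact h')
  have hle : geomTorsion W (p : ℤ) ≤ Dp :=
    W.geomTorsion_le_of_stable_divisible hprim' hdiv' hstab' hne'
  exact hP₁ (Subtype.ext (by rw [AddSubgroup.torsionBy.coe_smul]; exact (hmemDp.mp (hle P₁.2)).2))

/-- **The image of `Γ_ℚ` on a non-zero stable divisible subgroup of `E[p^∞]` is non-abelian** (`p`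
odd, every elliptic curve over `ℚ`): for `D ≤ E(ℚ̄)` `p`-primary, `p`-divisible, `Γ_ℚ`-stable and
non-zero there are `σ, τ ∈ Γ_ℚ` and `P ∈ D` with `σ τ P ≠ τ σ P` (the previous theorem, positively).
[cite: Kato2004Asterisque, §13.8 (p. 228)] -/
theorem exists_smul_smul_ne_of_stable_divisible (hp2 : p ≠ 2) {D : AddSubgroup W.geomPoints}
    (hprim : ∀ P ∈ D, ∃ k : ℕ, p ^ k • P = 0)
    (hdiv : ∀ P ∈ D, ∃ Q ∈ D, p • Q = P)
    (hstab : ∀ (σ : Field.absoluteGaloisGroup ℚ) (P : W.geomPoints), P ∈ D → σ • P ∈ D)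
    (hne : D ≠ ⊥) :
    ∃ (σ τ : Field.absoluteGaloisGroup ℚ) (P : W.geomPoints), P ∈ D ∧ σ • τ • P ≠ τ • σ • P := by
  by_contra h
  push Not at h
  exact W.not_forall_smul_comm_of_stable_divisible hp2 hprim hdiv hstab hne
    fun σ τ P hP ↦ h σ τ P hP

end WeierstrassCurve

end
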